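import Summits.CriticalPhenomena.PercolationContinuityZ3.Theorems.FK.LocalObservableCLT
import Summits.CriticalPhenomena.PercolationContinuityZ3.Theorems.FK.WeakMixingPlanarSupercritical
import HarnessLib

/-!
# CENTRAL LIMIT THEOREM FOR ARBITRARY LOCAL OBSERVABLES OF THE PLANAR RANDOM-CLUSTER MEASURE `φ^b_{p,q}` AT EVERY
# `p ≠ p_sd(q) = √q/(1+√q)` (`q ≥ 1`, both phases): `(Σ_{z∈Λ_n} f(ω − z) − E)/√|Λ_n| ⇒ N(0, σ²_f)`, `f = Σ_a c_a 1_{E_a}`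

Claimed R42 (8)(c) in the cell INBOX at 2026-08-28T14:25:01Z by fkp-10a gen 354 (NEW CLAIM #3 of the gen), addressed to coordinator fk-4 g274 (seated 13:10Z 2026-08-28 by l.8389; R151 l.8390, R152 l.8413); lineage row FO-10a-g354g (self-suggested), package g354-cltgeneral, label GD-E.
Helper file of the `fk-continuity` build cell (bschramm lane; `--supports stmt-CriticalPhenomena-4575`); builds on
p205010 (kernel theorem, internal audit signed; external expert review pending). No definitions, no named facts, no
sorries; standard axioms. UNCONDITIONAL.

The planar companion of `LocalObservableCLT.lean` (which treats `0 ≤ p < p_c(q)` in every `d ≥ 2`): on `ℤ²` the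
random-cluster measure is exponentially weak mixing at EVERY `p ≠ p_sd(q)` — below `p_sd(q) = p_c(q)` by sharpness,
above it by planar duality (tree: `exists_exp_weakMixing_two_of_ne_selfDual`, file `WeakMixingPlanarSupercritical`) —
so the translation mixing of local events, the summability of `z ↦ Cov(1_E, 1_{E'} ∘ T_z)` and hence Newman's CLT for
dominated fields (`tendstoInDistribution_boxSum_of_dominated`, with the dominator `(Σ|c_a|)·N_F` of
`abs_indicator_sub_le_openCount_sub`) go through in the SUPERCRITICAL planar phase as well:

* `exists_exp_translate_mixing_two_of_ne_selfDual` — `|φ^b(E ∩ {ω | ω + v ∈ E′}) − φ^b(E)φ^b(E′)| ≤ 4|F|e^{−c(‖v‖_∞ − 2k − 4)}`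
  for `E, E′` determined by `F, F′ ⊆ E(Λ_k)`, `‖v‖_∞ > 2k + 4`, `p ≠ p_sd(q)`;
* `exists_abs_cov_indicator_shift_two_le` — `|Cov(1_E, 1_{E'}∘T_z)| ≤ 4(|F|+1)e^{c(2k+4)}e^{−c‖z‖_∞}`;
* `tendstoInDistribution_localObservable_two` — **the CLT** at every `p ∈ [0,1]`, `p ≠ p_sd(q)`, both `b`:
  `(Σ_{z∈Λ_n} f(ω − z) − E_{φ^b}[…])/√|Λ_n| → N(0, σ²_f)`, `σ²_f = Σ_z Cov_{φ^b}(f, f ∘ T_z)` (`≥ 0`, as an `ℝ≥0`).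

Nothing is claimed AT `p_sd(q)`, and no non-degeneracy (`σ²_f > 0`) is claimed.

## References

* C. M. Newman, *Normal fluctuations and the FKG inequalities*, Comm. Math. Phys. 74 (1980) 119–128, Thm. 2 and the
  remark after (12). [Newman1980]
* G. Grimmett, *The Random-Cluster Model*, Springer 2006, Thm. (4.17)(b), Thm. (4.19)(b), §6.2 Thm. (6.17). [Grimmett2006]
* K. S. Alexander, *On weak mixing in lattice models*, PTRF 110 (1998) 441–471, (1.1), Thm. 3.4, Remark 3.5. [Alexander1998]
-/

noncomputable section

namespace Summit.CriticalPhenomena.PercolationContinuityZ3.Theorems.FK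

namespace NewmanCLT

open MeasureTheory ProbabilityTheory Complex Finset Filter Topology
open Literature.Probability.Percolation Literature.Probability.LatticeModels Literature.Barriers.CriticalPhenomena
open BoundaryInfluence

variable {p q : ℝ}

/-! ### Translation mixing of local events at `p ≠ p_sd(q)` -/

/-- **EXPONENTIAL MIXING UNDER TRANSLATIONS OF THE PLANAR RANDOM-CLUSTER MEASURE AT `p ≠ p_sd(q)`** (`q ≥ 1`,
`p ∈ [0,1]`, both `b`): there is `c > 0` such that for every `k`, all events `E, E′` determined by `F, F′ ⊆ E(Λ_k)`
and every `v ∈ ℤ²` with `‖v‖_∞ > 2k + 4`: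
`|φ^b_{p,q}(E ∩ {ω | ω + v ∈ E′}) − φ^b_{p,q}(E)·φ^b_{p,q}(E′)| ≤ 4·|F|·e^{−c(‖v‖_∞ − 2k − 4)}`
(weak mixing with `n = ‖v‖_∞ − k − 1`: the translate of `E′` is determined off `E_{Λ_n}` and has the same mass).
[cite: Alexander1998, (1.1), Thm. 3.4 and Remark 3.5; Grimmett2006, Thm. (4.19)(b), Thm. (6.17)] -/
theorem exists_exp_translate_mixing_two_of_ne_selfDual (hq : 1 ≤ q) (hp : p ∈ Set.Icc (0 : ℝ) 1)
    (hne : p ≠ Real.sqrt q / (1 + Real.sqrt q)) :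
    ∃ c : ℝ, 0 < c ∧ ∀ (b : Bool) ⦃k : ℕ⦄ ⦃F F' : Finset (Sym2 (Site 2))⦄,
      F ⊆ edgesIn (zdGraph 2) (box 2 k) → F' ⊆ edgesIn (zdGraph 2) (box 2 k) →
      ∀ ⦃E E' : Set (BondConfig (Site 2))⦄, DeterminedBy E ↑F → DeterminedBy E' ↑F' →
      ∀ ⦃v : Site 2⦄, 2 * k + 4 < siteRad v →
        |(rcLimit 2 b p q).real (E ∩ BondConfig.relabel (sym2Equiv (Site.shift v)) ⁻¹' E') -
            (rcLimit 2 b p q).real E * (rcLimit 2 b p q).real E'| ≤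
          4 * #F * Real.exp (-(c * ((siteRad v : ℝ) - 2 * k - 4))) := by
  obtain ⟨c, hc, h⟩ := exists_exp_weakMixing_two_of_ne_selfDual hq hp hne
  refine ⟨c, hc, fun b k F F' hF hF' E E' hE hE' v hv => ?_⟩
  have hBL : IsBoxLimit 2 b p q (rcLimit 2 b p q) := isBoxLimit_rcLimit b hp hq
  haveI := hBL.isProbabilityMeasure
  -- the translate of `E'` is determined off `E_{Λ_n}`, `n = ‖v‖ − k − 1`, and has the same probability
  set n : ℕ := siteRad v - k - 1 with hn
  have hkn : k + 3 < n := by omega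
  have hT := disjoint_map_shift_edgesIn_box hF' (v := v) (n := n) (by omega)
  have hH := determinedBy_preimage_relabel_shift hE' v
  have hshift : (rcLimit 2 b p q).real (BondConfig.relabel (sym2Equiv (Site.shift v)) ⁻¹' E') = (rcLimit 2 b p q).real E' := by
    rw [measureReal_def, hBL.measure_preimage_relabel_shift hp hq v E', measureReal_def]
  have key := h b hkn hF hE _ hT hH
  have hcast : ((n : ℝ) - k - 3) = (siteRad v : ℝ) - 2 * k - 4 := by
    rw [hn, Nat.cast_sub (by omega), Nat.cast_sub (by omega), Nat.cast_one]; ring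
  rw [hshift, hcast] at key
  refine key.trans ?_
  have h1 : (rcLimit 2 b p q).real E' ≤ 1 := measureReal_le_one
  have hF0 : (0 : ℝ) ≤ #F := Nat.cast_nonneg _
  have hexp : 0 ≤ Real.exp (-(c * ((siteRad v : ℝ) - 2 * k - 4))) := (Real.exp_pos _).le
  calc 4 * (rcLimit 2 b p q).real E' * #F * Real.exp (-(c * ((siteRad v : ℝ) - 2 * k - 4)))
      ≤ 4 * 1 * #F * Real.exp (-(c * ((siteRad v : ℝ) - 2 * k - 4))) := by gcongr
    _ = 4 * #F * Real.exp (-(c * ((siteRad v : ℝ) - 2 * k - 4))) := by ring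

/-! ### Covariance decay for pairs of local events at `p ≠ p_sd(q)` -/

/-- **`|Cov_{φ^b}(1_E, 1_{E'} ∘ T_z)| ≤ 4(|F|+1)e^{c(2k+4)}·e^{−c‖z‖_∞}`** on `ℤ²` for any two events `E, E'` determined
by `F ⊆ E(Λ_k)`, `p ∈ [0,1]`, `p ≠ p_sd(q)`, uniformly in `E, E'`, `b`, `z`.
[cite: Alexander1998, (1.1) and Remark 3.5; Grimmett2006, Thm. (6.17)] -/
theorem exists_abs_cov_indicator_shift_two_le (hq : 1 ≤ q) (hp : p ∈ Set.Icc (0 : ℝ) 1)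
    (hne : p ≠ Real.sqrt q / (1 + Real.sqrt q)) {k : ℕ} {F : Finset (Sym2 (Site 2))}
    (hF : F ⊆ edgesIn (zdGraph 2) (box 2 k)) :
    ∃ c : ℝ, 0 < c ∧ ∀ (b : Bool) ⦃E E' : Set (BondConfig (Site 2))⦄, DeterminedBy E ↑F → DeterminedBy E' ↑F →
      ∀ z : Site 2,
      |cov[E.indicator (1 : BondConfig (Site 2) → ℝ), fun ω => E'.indicator (1 : BondConfig (Site 2) → ℝ)
          (BondConfig.relabel (sym2Equiv (Site.shift (-z))) ω); rcLimit 2 b p q]| ≤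
        4 * (#F + 1) * Real.exp (c * (2 * k + 4)) * Real.exp (-(c * siteRad z)) := by
  obtain ⟨c, hc, h⟩ := exists_exp_translate_mixing_two_of_ne_selfDual hq hp hne
  refine ⟨c, hc, fun b E E' hE hE' z => ?_⟩
  haveI := isProbabilityMeasure_rcLimit (d := 2) b p q
  have hEm : MeasurableSet E := measurableSet_of_isLocalEvent_holds ⟨F, hE⟩
  have hE'm : MeasurableSet E' := measurableSet_of_isLocalEvent_holds ⟨F, hE'⟩
  set P := rcLimit 2 b p q with hP
  set A := BondConfig.relabel (sym2Equiv (Site.shift (-z))) ⁻¹' E' with hA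
  have hAm : MeasurableSet A := (BondConfig.relabel (sym2Equiv (Site.shift (-z)))).measurable hE'm
  have hind : (fun ω => E'.indicator (1 : BondConfig (Site 2) → ℝ) (BondConfig.relabel (sym2Equiv (Site.shift (-z))) ω)) =
      A.indicator (1 : BondConfig (Site 2) → ℝ) := by
    funext ω
    by_cases hω : BondConfig.relabel (sym2Equiv (Site.shift (-z))) ω ∈ E'
    · rw [Set.indicator_of_mem hω, Set.indicator_of_mem (Set.mem_preimage.2 hω), Pi.one_apply, Pi.one_apply]
    · rw [Set.indicator_of_notMem hω, Set.indicator_of_notMem (fun h' => hω (Set.mem_preimage.1 h'))]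
  rw [hind, covariance_indicator_one_eq _ hEm hAm]
  have hAE : P.real A = P.real E' := by
    rw [measureReal_def, hA, hP, (isBoxLimit_rcLimit b hp hq).measure_preimage_relabel_shift hp hq (-z) E', measureReal_def]
  rw [hAE]
  have htriv : |P.real (E ∩ A) - P.real E * P.real E'| ≤ 1 := by
    have h1 : P.real (E ∩ A) ≤ 1 := measureReal_le_one
    have h2 : P.real E ≤ 1 := measureReal_le_one
    have h3 : P.real E' ≤ 1 := measureReal_le_one
    have h4 : 0 ≤ P.real (E ∩ A) := measureReal_nonneg
    have h5 : 0 ≤ P.real E := measureReal_nonneg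
    have h6 : 0 ≤ P.real E' := measureReal_nonneg
    rw [abs_le]; constructor <;> nlinarith
  have hC1 : (1 : ℝ) ≤ 4 * (#F + 1) * Real.exp (c * (2 * k + 4)) * Real.exp (-(c * siteRad z)) ↔
      Real.exp (c * siteRad z) ≤ 4 * (#F + 1) * Real.exp (c * (2 * k + 4)) := by
    rw [Real.exp_neg, ← div_eq_mul_inv, le_div_iff₀ (Real.exp_pos _), one_mul]
  by_cases hm : siteRad z ≤ 2 * k + 4
  · refine htriv.trans (hC1.2 ?_)
    have h1 : Real.exp (c * siteRad z) ≤ Real.exp (c * (2 * k + 4)) :=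
      Real.exp_le_exp.2 (mul_le_mul_of_nonneg_left (by exact_mod_cast hm) hc.le)
    have h2 : (1 : ℝ) ≤ 4 * (#F + 1) := by
      have : (0 : ℝ) ≤ #F := Nat.cast_nonneg _
      linarith
    calc Real.exp (c * siteRad z) ≤ 1 * Real.exp (c * (2 * k + 4)) := by rw [one_mul]; exact h1
      _ ≤ 4 * (#F + 1) * Real.exp (c * (2 * k + 4)) := mul_le_mul_of_nonneg_right h2 (Real.exp_pos _).le
  · rw [not_le] at hm
    have key := h b hF hF hE hE' (v := -z) (by rw [siteRad_neg]; exact_mod_cast hm)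
    rw [siteRad_neg] at key
    refine key.trans ?_
    have e : Real.exp (-(c * ((siteRad z : ℝ) - 2 * k - 4))) = Real.exp (c * (2 * k + 4)) * Real.exp (-(c * siteRad z)) := by
      rw [← Real.exp_add]; congr 1; ring
    rw [e]
    have : (4 : ℝ) * #F ≤ 4 * (#F + 1) := by linarith
    have hpos : 0 ≤ Real.exp (c * (2 * k + 4)) * Real.exp (-(c * siteRad z)) := by positivity
    calc 4 * (#F : ℝ) * (Real.exp (c * (2 * k + 4)) * Real.exp (-(c * siteRad z)))
        ≤ 4 * (#F + 1) * (Real.exp (c * (2 * k + 4)) * Real.exp (-(c * siteRad z))) :=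
          mul_le_mul_of_nonneg_right this hpos
      _ = _ := by ring

/-! ### The central limit theorem for planar local observables off `p_sd(q)` -/

/-- **CENTRAL LIMIT THEOREM FOR LOCAL OBSERVABLES OF THE PLANAR RANDOM-CLUSTER MEASURE AT EVERY `p ≠ p_sd(q)`**:
for `d = 2`, `q ≥ 1`, `p ∈ [0,1]`, `p ≠ √q/(1+√q)` (BOTH phases), both `b`, a finite edge set `F ⊆ E(Λ_k)`, finitely many events `E_a` (`a ∈ A`) determined by `F`
and real coefficients `c_a` — so `f = Σ_a c_a 1_{E_a}` is an ARBITRARY function of the edges of `F` when the `E_a` run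
over cylinder events — the sums `S_n = Σ_{z∈Λ_n} f(ω − z)` satisfy `(S_n − E_{φ^b} S_n)/√|Λ_n| → N(0, σ²_f)` in
distribution, `σ²_f = Σ_{z∈ℤ^d} Cov_{φ^b}(f, f ∘ T_z)` (`≥ 0`), for any `Y ~ gaussianReal 0 v`, `v = σ²_f`.
[cite: Newman1980, Thm. 2 and the remark after (12); Grimmett2006, Thm. (4.17)(b), (4.19)(b), Thm. (6.17); Alexander1998, (1.1), Remark 3.5] -/
theorem tendstoInDistribution_localObservable_two {Ω' : Type*} {mΩ' : MeasurableSpace Ω'} {P' : Measure Ω'}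
    [IsProbabilityMeasure P'] {Y : Ω' → ℝ} {ι : Type*} (hq : 1 ≤ q) (hp : p ∈ Set.Icc (0 : ℝ) 1)
    (hne : p ≠ Real.sqrt q / (1 + Real.sqrt q)) (b : Bool) {k : ℕ} {F : Finset (Sym2 (Site 2))}
    (hF : F ⊆ edgesIn (zdGraph 2) (box 2 k)) (A : Finset ι) (c : ι → ℝ) {E : ι → Set (BondConfig (Site 2))}
    (hE : ∀ a ∈ A, DeterminedBy (E a) ↑F) {v : NNReal}
    (hv : (v : ℝ) = ∑' z : Site 2, cov[fun ω => ∑ a ∈ A, c a * (E a).indicator (1 : BondConfig (Site 2) → ℝ) ω,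
      fun ω => ∑ a ∈ A, c a * (E a).indicator (1 : BondConfig (Site 2) → ℝ)
        (BondConfig.relabel (sym2Equiv (Site.shift (-z))) ω); rcLimit 2 b p q])
    (hY : HasLaw Y (gaussianReal 0 v) P') :
    haveI := isProbabilityMeasure_rcLimit (d := 2) b p q
    TendstoInDistribution (fun (n : ℕ) (ω : BondConfig (Site 2)) => (Real.sqrt #(box 2 n))⁻¹ *
        (∑ z ∈ box 2 n, ∑ a ∈ A, c a * (E a).indicator (1 : BondConfig (Site 2) → ℝ)
            (BondConfig.relabel (sym2Equiv (Site.shift (-z))) ω) -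
          ∫ ω', ∑ z ∈ box 2 n, ∑ a ∈ A, c a * (E a).indicator (1 : BondConfig (Site 2) → ℝ)
            (BondConfig.relabel (sym2Equiv (Site.shift (-z))) ω') ∂(rcLimit 2 b p q)))
      atTop Y (fun _ => rcLimit 2 b p q) P' := by
  haveI := isProbabilityMeasure_rcLimit (d := 2) b p q
  have hμ : IsPositivelyAssociated (rcLimit 2 b p q) := isPositivelyAssociated_rcLimit b hp hq
  have hEm : ∀ a ∈ A, MeasurableSet (E a) := fun a ha => measurableSet_of_isLocalEvent_holds ⟨F, hE a ha⟩
  -- the observable `f`, measurable and bounded by `C = Σ|c_a|`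
  have hfm : Measurable fun ω : BondConfig (Site 2) => ∑ a ∈ A, c a * (E a).indicator (1 : BondConfig (Site 2) → ℝ) ω :=
    Finset.measurable_sum _ fun a ha => (measurable_const.indicator (hEm a ha)).const_mul _
  have hfb : ∀ ω : BondConfig (Site 2), |∑ a ∈ A, c a * (E a).indicator (1 : BondConfig (Site 2) → ℝ) ω| ≤ ∑ a ∈ A, |c a| :=
    fun ω => (Finset.abs_sum_le_sum_abs _ _).trans (Finset.sum_le_sum fun a _ => by
      rw [abs_mul]; exact (mul_le_mul_of_nonneg_left (abs_indicator_one_le_one _ _) (abs_nonneg _)).trans_eq (mul_one _))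
  -- the dominator `C · N_F`, measurable and bounded by `C · #F`
  have hedge : ∀ e : Sym2 (Site 2), Measurable fun ω : BondConfig (Site 2) =>
      ({ω' : BondConfig (Site 2) | e ∈ ω'}).indicator (1 : BondConfig (Site 2) → ℝ) ω := fun e =>
    measurable_const.indicator (measurableSet_of_isLocalEvent_holds (isLocalEvent_setOf_mem _))
  have hNm : Measurable fun ω : BondConfig (Site 2) => (∑ a ∈ A, |c a|) *
      ∑ e ∈ F, ({ω' : BondConfig (Site 2) | e ∈ ω'}).indicator (1 : BondConfig (Site 2) → ℝ) ω :=
    (Finset.measurable_sum _ fun e _ => hedge e).const_mul _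
  have hNb : ∀ ω : BondConfig (Site 2), |(∑ a ∈ A, |c a|) *
      ∑ e ∈ F, ({ω' : BondConfig (Site 2) | e ∈ ω'}).indicator (1 : BondConfig (Site 2) → ℝ) ω| ≤ (∑ a ∈ A, |c a|) * #F := by
    intro ω
    rw [abs_mul, abs_of_nonneg (Finset.sum_nonneg fun a _ => abs_nonneg _)]
    refine mul_le_mul_of_nonneg_left ?_ (Finset.sum_nonneg fun a _ => abs_nonneg _)
    refine (Finset.abs_sum_le_sum_abs _ _).trans ?_
    calc ∑ e ∈ F, |({ω' : BondConfig (Site 2) | e ∈ ω'}).indicator (1 : BondConfig (Site 2) → ℝ) ω|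
        ≤ ∑ _e ∈ F, (1 : ℝ) := Finset.sum_le_sum fun e _ => abs_indicator_one_le_one _ _
      _ = #F := by simp
  -- the translation operators are measurable
  have hT : ∀ z : Site 2, Measurable (BondConfig.relabel (sym2Equiv (Site.shift (-z))) :
      BondConfig (Site 2) → BondConfig (Site 2)) := fun z => (BondConfig.relabel _).measurable
  -- covariance decay constants
  obtain ⟨cst, hcst, hpair⟩ := exists_abs_cov_indicator_shift_two_le hq hp hne hF
  have hsumexp := (summable_exp_neg_mul_siteRad (d := 2) hcst).mul_left
    ((∑ a ∈ A, |c a|) * (∑ a ∈ A, |c a|) * (4 * (#F + 1) * Real.exp (cst * (2 * k + 4))))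
  have hsumexp' := (summable_exp_neg_mul_siteRad (d := 2) hcst).mul_left
    ((∑ e ∈ F, |(∑ a ∈ A, |c a|)|) * (∑ e ∈ F, |(∑ a ∈ A, |c a|)|) * (4 * (#F + 1) * Real.exp (cst * (2 * k + 4))))
  have hdetEdge : ∀ e ∈ F, DeterminedBy {ω : BondConfig (Site 2) | e ∈ ω} ↑F := fun e he => by
    rw [determinedBy_iff]; intro ω₁ ω₂ hω
    have := Set.ext_iff.1 hω e
    simp only [Set.mem_inter_iff, Finset.mem_coe, he, and_true] at this
    exact this
  refine tendstoInDistribution_boxSum_of_dominated (μ := rcLimit 2 b p q)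
    (X := fun z ω => ∑ a ∈ A, c a * (E a).indicator (1 : BondConfig (Site 2) → ℝ)
      (BondConfig.relabel (sym2Equiv (Site.shift (-z))) ω))
    (Xd := fun z ω => (∑ a ∈ A, |c a|) * ∑ e ∈ F, ({ω' : BondConfig (Site 2) | e ∈ ω'}).indicator
      (1 : BondConfig (Site 2) → ℝ) (BondConfig.relabel (sym2Equiv (Site.shift (-z))) ω))
    (γ := fun z => cov[fun ω => ∑ a ∈ A, c a * (E a).indicator (1 : BondConfig (Site 2) → ℝ) ω,
      fun ω => ∑ a ∈ A, c a * (E a).indicator (1 : BondConfig (Site 2) → ℝ)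
        (BondConfig.relabel (sym2Equiv (Site.shift (-z))) ω); rcLimit 2 b p q])
    (γd := fun z => cov[fun ω => (∑ a ∈ A, |c a|) * ∑ e ∈ F, ({ω' : BondConfig (Site 2) | e ∈ ω'}).indicator
        (1 : BondConfig (Site 2) → ℝ) ω,
      fun ω => (∑ a ∈ A, |c a|) * ∑ e ∈ F, ({ω' : BondConfig (Site 2) | e ∈ ω'}).indicator
        (1 : BondConfig (Site 2) → ℝ) (BondConfig.relabel (sym2Equiv (Site.shift (-z))) ω); rcLimit 2 b p q])
    one_le_two hμ (fun z => hfm.comp (hT z)) (Finset.sum_nonneg fun a _ => abs_nonneg _)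
    (fun z ω => hfb _) (fun x y => covariance_comp_shift_eq b hp hq hfm hfm x y) ?_ (fun z => hNm.comp (hT z))
    (fun z ω => hNb _) (fun x y => covariance_comp_shift_eq b hp hq hNm hNm x y) ?_ ?_ hv hY
  · -- (D) for `f`
    refine Summable.of_norm_bounded hsumexp fun z => ?_
    rw [Real.norm_eq_abs]
    refine (abs_cov_combination_shift_le (rcLimit 2 b p q) A A c c hEm hEm z
      (fun a ha a' ha' => hpair b (hE a ha) (hE a' ha') z)).trans (le_of_eq ?_)
    ring
  · -- (D) for the dominator
    refine Summable.of_norm_bounded hsumexp' fun z => ?_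
    rw [Real.norm_eq_abs]
    have h := abs_cov_combination_shift_le (rcLimit 2 b p q) F F (fun _ => ∑ a ∈ A, |c a|) (fun _ => ∑ a ∈ A, |c a|)
      (E := fun e => {ω : BondConfig (Site 2) | e ∈ ω}) (E' := fun e => {ω : BondConfig (Site 2) | e ∈ ω})
      (fun e _ => measurableSet_of_isLocalEvent_holds (isLocalEvent_setOf_mem _))
      (fun e _ => measurableSet_of_isLocalEvent_holds (isLocalEvent_setOf_mem _)) z
      (fun e he e' he' => hpair b (hdetEdge e he) (hdetEdge e' he') z)
    simp only [← Finset.mul_sum] at h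
    refine h.trans (le_of_eq ?_)
    ring
  · -- domination
    intro z ω ω' hle
    have hle' := BondConfig.relabel_mono (sym2Equiv (Site.shift (-z))) hle
    rw [← Finset.sum_sub_distrib, ← mul_sub]
    refine (Finset.abs_sum_le_sum_abs _ _).trans ?_
    rw [Finset.sum_mul]
    refine Finset.sum_le_sum fun a ha => ?_
    rw [← mul_sub, abs_mul]
    exact mul_le_mul_of_nonneg_left (abs_indicator_sub_le_openCount_sub (hE a ha) hle') (abs_nonneg _)

end NewmanCLT

end Summit.CriticalPhenomena.PercolationContinuityZ3.Theorems.FK
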